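import Summits.CriticalPhenomena.PercolationContinuityZ3.Theorems.Transplant.SkelNegBParamsBridgeF
import HarnessLib

/-!
# N1 params, chain of record `NegB`, part ClearF: THE ONE v-FREE α-FLOOR OF THE y′-FACE RUN AT THE WIDE BRIDGE in p1-g13's served shape
# `M + n_L + (N+1)·R′ < c_lo` (`hclrP_of_clearF` / `hclrM_of_clearF`, SkelPhiFaceClearFloorsY p314730), for all three bridge frames:
# **`clearF_s`** (`c_lo = n_L + nBF − RA′`), **`clearF_d`** (steep transposed, `c_lo = n_L − RA′ + |hBF|`), **`clearF_t`** (flat transposed,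
# `c_lo = n_L − RA′ + ℓBF − |hBF| − 11`) — from part BridgeF's `clearF : M_u + (c+1)·RA′ < nBF − RA′` with `N + 1 ≤ c`, `R′ ≤ RA′` (stmt-g16 2026-08-22;
# p1-g13's ask, lane INBOX 02:25:38Z; origin identities = `yLFs_zero` (FramesF) / `yLFd_zero`, `yLFt_zero` (FramesF2))
The transposed cases use the bridge pair's length floor `2·bF + 27 ≤ ℓBF` (`ℓBF_ge`, from the pair's geometric clause) and the case split
`2|hBF| > ℓBF` / `2|hBF| ≤ ℓBF` exactly as the (R) column's `hclr_d` / `hclr_t` (RootCasesT). Cell-free; stands under (ζ′) with `c := 1000·Kq + 1`.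
builds on p205010 (kernel theorem, internal audit signed; external expert review pending) — nothing in this file uses p205010; NOTHING is claimed about
the node `SamePDropOfSkeletonNeg₁` (OPEN; additive closure adopted on accept, lead g7 01:38:43Z).
Lane `prim-bschramm-*`, seat `prim-bschramm-stmt` (gen 16); helper file (`--supports stmt-CriticalPhenomena-4575 --as helper`); ledger HOME/prim-bschramm-stmt/NEG-PARAMS.md.
* `recession_le` (`(N+1)·R′ ≤ c·RA′`), **`clearF_s`**, `abs_hBF_ge_of_side`, **`clearF_d`**, `sub_abs_hBF_ge_of_top`, **`clearF_t`**.
[cite: KozmaNitzan2024, §4 Lemma 11 (pp. 22–23)] [cite: MartineauTassion2017, §3.2 Lemma 3.5]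
-/

noncomputable section

open scoped Classical

namespace Summit.CriticalPhenomena.PercolationContinuityZ3.Theorems.Transplant

namespace PlanarSkeletonNeg

namespace NegB

open Literature.Probability.Percolation Literature.Probability.LatticeModels SimpleGraph
open SkelConc (Consts)
open Skelφ.StepI (DataN)
open Neg

namespace KS

section ClearF

variable (κ : Consts) {V : Type} [Countable V] {G : SimpleGraph V} [G.LocallyFinite] (Φ : PlanarSkeletonNeg G) (t : V)
  (p : unitInterval) (D : DataN V) (c mk : ℕ) {N R's : ℕ}

/-- The recession of `N + 1 ≤ c` regions at `R′ ≤ RA′` per region is `≤ c·RA′`. [folklore] -/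
theorem recession_le (hc : N + 1 ≤ c) (hR : R's ≤ RA' κ Φ t p D mk) : ((N : ℤ) + 1) * (R's : ℤ) ≤ (c : ℤ) * (RA' κ Φ t p D mk : ℤ) := by
  have h : (N + 1) * R's ≤ c * RA' κ Φ t p D mk := Nat.mul_le_mul hc hR
  have h' : (((N + 1) * R's : ℕ) : ℤ) ≤ ((c * RA' κ Φ t p D mk : ℕ) : ℤ) := by exact_mod_cast h
  push_cast at h'
  linarith

/-- **The α-floor, case same** (`c_lo := n_L + nBF − RA′` = core 1's frame-α start, `mem_core1F_same_iff`): `M_u + n_L + (N+1)·R′ < c_lo` for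
`N + 1 ≤ c`, `R′ ≤ RA′` — any `n_L`. [folklore] -/
theorem clearF_s (nL : ℕ) (hc : N + 1 ≤ c) (hR : R's ≤ RA' κ Φ t p D mk) :
    ((Mu D : ℕ) : ℤ) + nL + ((N : ℤ) + 1) * (R's : ℤ) < (nL : ℤ) + nBF κ Φ t p D c mk - RA' κ Φ t p D mk := by
  have h1 := clearF κ Φ t p D c mk
  have h2 := recession_le κ Φ t p D c mk hc hR
  have h3 : (0 : ℤ) ≤ (RA' κ Φ t p D mk : ℤ) := by positivity
  nlinarith

/-- Steep transposed bridge: `2|hBF| > ℓBF ≥ 2·bF + 27` gives `|hBF| ≥ bF + 14 = M_u + (c+2)·RA′ + 15`. [folklore] -/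
theorem abs_hBF_ge_of_side (hside : ℓBF κ Φ t p D c mk < 2 * (hBF κ Φ t p D c mk).natAbs) (hℓb : 2 * bF κ Φ t p D c mk + 27 ≤ ℓBF κ Φ t p D c mk) :
    ((Mu D : ℕ) : ℤ) + ((c : ℤ) + 2) * (RA' κ Φ t p D mk : ℤ) + 15 ≤ |hBF κ Φ t p D c mk| := by
  have hb := (bF_facts κ Φ t p D c mk).1
  have h1 : Mu D + (c + 2) * RA' κ Φ t p D mk + 15 ≤ (hBF κ Φ t p D c mk).natAbs := by omega
  have h2 : ((Mu D + (c + 2) * RA' κ Φ t p D mk + 15 : ℕ) : ℤ) ≤ (((hBF κ Φ t p D c mk).natAbs : ℕ) : ℤ) := by exact_mod_cast h1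
  push_cast [Int.natCast_natAbs] at h2
  exact h2

/-- **The α-floor, steep transposed case** (`c_lo := n_L − RA′ + |hBF|`, `mem_core1F_side_iff`): `M_u + n_L + (N+1)·R′ < c_lo` for `N + 1 ≤ c`,
`R′ ≤ RA′`, `2|hBF| > ℓBF`, `2·bF + 27 ≤ ℓBF` (`ℓBF_ge`). [folklore] -/
theorem clearF_d (nL : ℕ) (hc : N + 1 ≤ c) (hR : R's ≤ RA' κ Φ t p D mk) (hside : ℓBF κ Φ t p D c mk < 2 * (hBF κ Φ t p D c mk).natAbs)
    (hℓb : 2 * bF κ Φ t p D c mk + 27 ≤ ℓBF κ Φ t p D c mk) :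
    ((Mu D : ℕ) : ℤ) + nL + ((N : ℤ) + 1) * (R's : ℤ) < (nL : ℤ) - RA' κ Φ t p D mk + |hBF κ Φ t p D c mk| := by
  have h1 := abs_hBF_ge_of_side κ Φ t p D c mk hside hℓb
  have h2 := recession_le κ Φ t p D c mk hc hR
  have h3 : (0 : ℤ) ≤ (RA' κ Φ t p D mk : ℤ) := by positivity
  nlinarith

/-- Flat transposed bridge: `2|hBF| ≤ ℓBF`, `2·bF + 27 ≤ ℓBF` give `ℓBF − |hBF| − 11 ≥ bF + 2 = M_u + (c+2)·RA′ + 3`. [folklore] -/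
theorem sub_abs_hBF_ge_of_top (htop : 2 * (hBF κ Φ t p D c mk).natAbs ≤ ℓBF κ Φ t p D c mk) (hℓb : 2 * bF κ Φ t p D c mk + 27 ≤ ℓBF κ Φ t p D c mk) :
    ((Mu D : ℕ) : ℤ) + ((c : ℤ) + 2) * (RA' κ Φ t p D mk : ℤ) + 3 ≤ (ℓBF κ Φ t p D c mk : ℤ) - |hBF κ Φ t p D c mk| - 11 := by
  have hb := (bF_facts κ Φ t p D c mk).1
  have h1 : Mu D + (c + 2) * RA' κ Φ t p D mk + 3 + (hBF κ Φ t p D c mk).natAbs + 11 ≤ ℓBF κ Φ t p D c mk := by omega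
  have h2 : ((Mu D + (c + 2) * RA' κ Φ t p D mk + 3 + (hBF κ Φ t p D c mk).natAbs + 11 : ℕ) : ℤ) ≤ (ℓBF κ Φ t p D c mk : ℤ) := by exact_mod_cast h1
  push_cast [Int.natCast_natAbs] at h2
  linarith

/-- **The α-floor, flat transposed case** (`c_lo := n_L − RA′ + ℓBF − |hBF| − 11`, `mem_core1F_top_iff`): `M_u + n_L + (N+1)·R′ < c_lo` for `N + 1 ≤ c`,
`R′ ≤ RA′`, `2|hBF| ≤ ℓBF`, `2·bF + 27 ≤ ℓBF`. [folklore] -/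
theorem clearF_t (nL : ℕ) (hc : N + 1 ≤ c) (hR : R's ≤ RA' κ Φ t p D mk) (htop : 2 * (hBF κ Φ t p D c mk).natAbs ≤ ℓBF κ Φ t p D c mk)
    (hℓb : 2 * bF κ Φ t p D c mk + 27 ≤ ℓBF κ Φ t p D c mk) :
    ((Mu D : ℕ) : ℤ) + nL + ((N : ℤ) + 1) * (R's : ℤ) < (nL : ℤ) - RA' κ Φ t p D mk + ((ℓBF κ Φ t p D c mk : ℤ) - |hBF κ Φ t p D c mk| - 11) := by
  have h1 := sub_abs_hBF_ge_of_top κ Φ t p D c mk htop hℓb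
  have h2 := recession_le κ Φ t p D c mk hc hR
  have h3 : (0 : ℤ) ≤ (RA' κ Φ t p D mk : ℤ) := by positivity
  nlinarith

end ClearF

end KS

end NegB

end PlanarSkeletonNeg

end Summit.CriticalPhenomena.PercolationContinuityZ3.Theorems.Transplant

end
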